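import Summits.CriticalPhenomena.CardyFormulaZ2.Theorems.CardyIKTransportIKLinearTransportLine
import Summits.CriticalPhenomena.CardyFormulaZ2.Theorems.CardyIKTransportIKLinearTransportDXCore3

/-!
# Pinned diagram exchange on cylinders — part 4

Helper file toward the stub `stub_DiagramExchange` of the line `pinned-diagram-exchange` (crux
stmt-CriticalPhenomena-5076): the pinned Yang–Baxter identity `DiagramExchangeAt L` on all cylinders `ℤ/L`, `L ≥ 3`,
by a train argument in the coloured partition category (see the final file for the overview).

PART 4: the bridge, graph half: the start necklace induces exactly the block diagram of the vocabulary file.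
-/

namespace Summit.CriticalPhenomena.CardyFormulaZ2.Theorems.IKLinearTransport.PinnedDiagramExchange

namespace DX

open SimpleGraph

section Bridge

variable {L : ℕ}

/-- Edges of a double-face piece of the start necklace. [folklore] -/
theorem start_D (τ : Fin 2 → Bool) (ξ ζ η : ZMod L → Bool) (a : Fin 2 × ZMod L → Bool)
    {i : Fin (L + 2)} (h : i.val < L) :
    pEdges ξ ζ (startNeck τ i) ((ι η a).1 i) ((ι η a).1 (i + 1)) ((ι η a).2 i) (Sum.inr i) (Sum.inr (i + 1)) =
      pieceE (.D (τ 0) (τ 1)) (ξ i.val) (ζ i.val) (ξ (i.val + 1)) (ζ (i.val + 1)) (η i.val) (η (i.val + 1))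
        (a (0, i.val), a (1, i.val)) (Sum.inl (0, (i.val : ZMod L))) (Sum.inl (2, (i.val : ZMod L)))
        (Sum.inl (0, (i.val : ZMod L) + 1)) (Sum.inl (2, (i.val : ZMod L) + 1)) (Sum.inr i) (Sum.inr (i + 1)) := by
  simp only [pEdges, startNeck, h, ↓reduceIte, ι, rowOf_lt h, rowOf_succ_lt h]

/-- Edges of an identity piece of the start necklace. [folklore] -/
theorem start_I (τ : Fin 2 → Bool) (ξ ζ η : ZMod L → Bool) (a : Fin 2 × ZMod L → Bool)
    {i : Fin (L + 2)} (h : ¬ i.val < L) :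
    pEdges ξ ζ (startNeck τ i) ((ι η a).1 i) ((ι η a).1 (i + 1)) ((ι η a).2 i) (Sum.inr i) (Sum.inr (i + 1)) =
      pieceE .I (ξ 0) (ζ 0) (ξ (0 + 1)) (ζ (0 + 1)) (η 0) (η 0) (false, false)
        (Sum.inl (0, 0)) (Sum.inl (2, 0)) (Sum.inl (0, 0 + 1)) (Sum.inl (2, 0 + 1)) (Sum.inr i) (Sum.inr (i + 1)) := by
  simp only [pEdges, startNeck, h, ↓reduceIte, ι, rowOf_ge h, rowOf_succ_ge h]

/-- Weight of a double-face piece of the start necklace. [folklore] -/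
theorem startW_D (τ : Fin 2 → Bool) (ξ ζ η : ZMod L → Bool) (a : Fin 2 × ZMod L → Bool)
    {i : Fin (L + 2)} (h : i.val < L) :
    pW ξ ζ (startNeck τ i) ((ι η a).1 i) ((ι η a).1 (i + 1)) ((ι η a).2 i) =
      pieceW (.D (τ 0) (τ 1)) (ξ i.val) (ζ i.val) (ξ (i.val + 1)) (ζ (i.val + 1)) (η i.val) (η (i.val + 1))
        (a (0, i.val), a (1, i.val)) := by
  simp only [pW, startNeck, h, ↓reduceIte, ι, rowOf_lt h, rowOf_succ_lt h]

/-- Identity pieces of the start necklace weigh `1` on the image of `ι`. [folklore] -/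
theorem startW_I (τ : Fin 2 → Bool) (ξ ζ η : ZMod L → Bool) (a : Fin 2 × ZMod L → Bool)
    {i : Fin (L + 2)} (h : ¬ i.val < L) :
    pW ξ ζ (startNeck τ i) ((ι η a).1 i) ((ι η a).1 (i + 1)) ((ι η a).2 i) = 1 := by
  simp [pW, startNeck, h, ι, rowOf_ge h, rowOf_succ_ge h, pieceW]

/-- The monochromatic block graph. [folklore] -/
def monoG (L : ℕ) (col : Fin 3 × ZMod L → Bool) (a : Fin 2 × ZMod L → Bool) :
    SimpleGraph (Fin 3 × ZMod L) :=
  fromRel fun x y => (blockGraph L a).Adj x y ∧ col x = col y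

/-- `blockCluster` is reachability in the monochromatic block graph. [folklore] -/
theorem mem_blockCluster_iff (col : Fin 3 × ZMod L → Bool) (a : Fin 2 × ZMod L → Bool)
    (x y : Fin 3 × ZMod L) : y ∈ blockCluster L col a x ↔ (monoG L col a).Reachable x y := by
  constructor
  · rintro ⟨hy, hr⟩
    let f : ((blockGraph L a).induce {z | col z = col x}) →g monoG L col a :=
      { toFun := Subtype.val
        map_rel' := fun {u v} huv => ⟨fun h => huv.ne (Subtype.ext h), Or.inl ⟨huv, u.2.trans v.2.symm⟩⟩ }
    exact hr.map f
  · rintro ⟨p⟩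
    suffices key : ∀ u (q : (monoG L col a).Walk u y) (hu : col u = col x),
        ∃ hy : col y = col x, ((blockGraph L a).induce {z | col z = col x}).Reachable ⟨u, hu⟩ ⟨y, hy⟩ by
      obtain ⟨hy, h⟩ := key x p rfl
      exact ⟨hy, h⟩
    intro u q
    clear p
    induction q with
    | nil => exact fun hu => ⟨hu, Reachable.refl _⟩
    | @cons u v w huv q ih =>
      intro hu
      have h1 : (blockGraph L a).Adj u v ∧ col u = col v := by
        rcases huv with ⟨-, ⟨h, hc⟩ | ⟨h, hc⟩⟩
        · exact ⟨h, hc⟩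
        · exact ⟨h.symm, hc.symm⟩
      obtain ⟨hy, hr⟩ := ih (h1.2.symm.trans hu)
      refine ⟨hy, Reachable.trans (Adj.reachable ?_) hr⟩
      exact h1.1

/-- An edge of the monochromatic block graph from the raw data. [folklore] -/
theorem monoG_adj {col : Fin 3 × ZMod L → Bool} {a : Fin 2 × ZMod L → Bool} {u v : Fin 3 × ZMod L}
    (hne : u ≠ v)
    (hR : (v.1 = u.1 ∧ v.2 = u.2 + 1) ∨ (v.1.val = u.1.val + 1 ∧ v.2 = u.2) ∨
      (∃ j : Fin 2, u.1 = j.castSucc ∧ v.1 = j.succ ∧ v.2 = u.2 + 1 ∧ a (j, u.2) = false) ∨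
      (∃ j : Fin 2, u.1 = j.castSucc ∧ v.1 = j.succ ∧ u.2 = v.2 + 1 ∧ a (j, v.2) = true))
    (hc : col u = col v) : (monoG L col a).Adj u v :=
  ⟨hne, Or.inl ⟨⟨hne, Or.inl hR⟩, hc⟩⟩

/-- The image in the block of a double-face piece of the start necklace consists of monochromatic
block edges. [folklore] -/
theorem stdD_adj (hL : 3 ≤ L) (τ₀ τ₁ : Bool) (ξ η ζ : ZMod L → Bool) (a : Fin 2 × ZMod L → Bool)
    (r : ZMod L) : ∀ e ∈ pieceE (.D τ₀ τ₁) (ξ r) (ζ r) (ξ (r + 1)) (ζ (r + 1)) (η r) (η (r + 1))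
      (a (0, r), a (1, r)) ((0 : Fin 3), r) (2, r) (0, r + 1) (2, r + 1) (1, r) (1, r + 1),
      (monoG L (colB ξ η ζ) a).Adj e.1 e.2 := by
  have hr := row_succ_ne hL r
  intro e he
  simp only [pieceE, List.mem_append, mem_ce, Bool.and_eq_true, beq_iff_eq, Bool.not_eq_true'] at he
  rcases he with (((((((((⟨h, rfl⟩ | ⟨h, rfl⟩) | ⟨h, rfl⟩) | ⟨h, rfl⟩) | ⟨h, rfl⟩) | ⟨h, rfl⟩) | ⟨h, rfl⟩) |
    ⟨⟨hb, h⟩, rfl⟩) | ⟨⟨hb, h⟩, rfl⟩) | ⟨⟨hb, h⟩, rfl⟩) | ⟨⟨hb, h⟩, rfl⟩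
  · exact monoG_adj (by simp [hr.symm]) (Or.inl ⟨rfl, rfl⟩) (by simpa [colB] using h)
  · exact monoG_adj (by simp [hr.symm]) (Or.inl ⟨rfl, rfl⟩) (by simpa [colB] using h)
  · exact monoG_adj (by simp) (Or.inr (Or.inl ⟨rfl, rfl⟩)) (by simpa [colB] using h)
  · exact monoG_adj (by simp) (Or.inr (Or.inl ⟨rfl, rfl⟩)) (by simpa [colB] using h)
  · exact monoG_adj (by simp) (Or.inr (Or.inl ⟨rfl, rfl⟩)) (by simpa [colB] using h)
  · exact monoG_adj (by simp) (Or.inr (Or.inl ⟨rfl, rfl⟩)) (by simpa [colB] using h)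
  · exact monoG_adj (by simp [hr.symm]) (Or.inl ⟨rfl, rfl⟩) (by simpa [colB] using h)
  · exact monoG_adj (by simp) (Or.inr (Or.inr (Or.inr ⟨0, rfl, rfl, rfl, hb⟩))) (by simpa [colB] using h)
  · exact monoG_adj (by simp) (Or.inr (Or.inr (Or.inl ⟨0, rfl, rfl, rfl, hb⟩))) (by simpa [colB] using h)
  · exact monoG_adj (by simp) (Or.inr (Or.inr (Or.inr ⟨1, rfl, rfl, rfl, hb⟩))) (by simpa [colB] using h)
  · exact monoG_adj (by simp) (Or.inr (Or.inr (Or.inl ⟨1, rfl, rfl, rfl, hb⟩))) (by simpa [colB] using h)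

/-- The same for the identity pieces (whose level edge becomes a loop). [folklore] -/
theorem stdI_adj (ξ η ζ : ZMod L → Bool) (a : Fin 2 × ZMod L → Bool) (cc cd : Bool) (bits : Bool × Bool)
    (c d : Fin 3 × ZMod L) : ∀ e ∈ pieceE .I (ξ 0) (ζ 0) cc cd (η 0) (η 0) bits
      ((0 : Fin 3), (0 : ZMod L)) (2, 0) c d (1, 0) (1, 0),
      e.1 = e.2 ∨ (monoG L (colB ξ η ζ) a).Adj e.1 e.2 := by
  intro e he
  simp only [pieceE, List.mem_append, mem_ce, beq_iff_eq] at he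
  rcases he with (((⟨h, rfl⟩ | ⟨h, rfl⟩) | ⟨h, rfl⟩) | ⟨h, rfl⟩) | ⟨-, rfl⟩
  · exact Or.inr (monoG_adj (by simp) (Or.inr (Or.inl ⟨rfl, rfl⟩)) (by simpa [colB] using h))
  · exact Or.inr (monoG_adj (by simp) (Or.inr (Or.inl ⟨rfl, rfl⟩)) (by simpa [colB] using h))
  · exact Or.inr (monoG_adj (by simp) (Or.inr (Or.inl ⟨rfl, rfl⟩)) (by simpa [colB] using h))
  · exact Or.inr (monoG_adj (by simp) (Or.inr (Or.inl ⟨rfl, rfl⟩)) (by simpa [colB] using h))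
  · exact Or.inl rfl

/-- Projection of the necklace vertices to the block. [folklore] -/
def ψ (L : ℕ) : Vx L → Fin 3 × ZMod L
  | Sum.inl x => x
  | Sum.inr i => (1, rowOf L i)

/-- Necklace edges project to monochromatic block paths. [folklore] -/
theorem N_to_M (hL : 3 ≤ L) (τ : Fin 2 → Bool) (ξ η ζ : ZMod L → Bool) (a : Fin 2 × ZMod L → Bool)
    {u v : Vx L} (h : (neckG (startNeck τ) ξ ζ (ι η a) fun _ => True).Reachable u v) :
    (monoG L (colB ξ η ζ) a).Reachable (ψ L u) (ψ L v) := by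
  have step : ∀ u v : Vx L, (u, v) ∈ neckE (startNeck τ) ξ ζ (ι η a) (fun _ => True) →
      (monoG L (colB ξ η ζ) a).Reachable (ψ L u) (ψ L v) := by
    rintro u v ⟨i, -, he⟩
    have hm := List.mem_map_of_mem (f := Prod.map (ψ L) (ψ L)) he
    by_cases hi : i.val < L
    · rw [start_D τ ξ ζ η a hi, pieceE_map] at hm
      simp only [ψ, rowOf_lt hi, rowOf_succ_lt hi] at hm
      exact (stdD_adj hL _ _ ξ η ζ a _ _ hm).reachable
    · rw [start_I τ ξ ζ η a hi, pieceE_map] at hm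
      simp only [ψ, rowOf_ge hi, rowOf_succ_ge hi] at hm
      rcases stdI_adj ξ η ζ a _ _ _ _ _ _ hm with h | h
      · simp only [Prod.map_apply] at h; rw [h]
      · exact h.reachable
  obtain ⟨p⟩ := h
  induction p with
  | nil => exact Reachable.refl _
  | @cons x y z hxy p ih =>
    refine Reachable.trans ?_ ih
    rcases hxy with ⟨-, h | h⟩
    · exact step _ _ h
    · exact (step _ _ h).symm

/-- An edge of the start necklace from a piece membership. [folklore] -/
theorem adjN {τ : Fin 2 → Bool} {ξ ζ η : ZMod L → Bool} {a : Fin 2 × ZMod L → Bool} (i : Fin (L + 2))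
    (u v : Vx L)
    (h : (u, v) ∈ pEdges ξ ζ (startNeck τ i) ((ι η a).1 i) ((ι η a).1 (i + 1)) ((ι η a).2 i)
      (Sum.inr i) (Sum.inr (i + 1))) (hne : u ≠ v) :
    (neckG (startNeck τ) ξ ζ (ι η a) fun _ => True).Adj u v :=
  ⟨hne, Or.inl ⟨i, trivial, h⟩⟩

/-- Membership of the eleven potential edges of a double-face piece. [folklore] -/
theorem memD {W : Type*} (τ₀ τ₁ ca cb cc cd clo chi : Bool) (bits : Bool × Bool) (a b c d vl vh : W) :
    (ca = cc → (a, c) ∈ pieceE (.D τ₀ τ₁) ca cb cc cd clo chi bits a b c d vl vh) ∧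
    (cb = cd → (b, d) ∈ pieceE (.D τ₀ τ₁) ca cb cc cd clo chi bits a b c d vl vh) ∧
    (ca = clo → (a, vl) ∈ pieceE (.D τ₀ τ₁) ca cb cc cd clo chi bits a b c d vl vh) ∧
    (clo = cb → (vl, b) ∈ pieceE (.D τ₀ τ₁) ca cb cc cd clo chi bits a b c d vl vh) ∧
    (cc = chi → (c, vh) ∈ pieceE (.D τ₀ τ₁) ca cb cc cd clo chi bits a b c d vl vh) ∧
    (chi = cd → (vh, d) ∈ pieceE (.D τ₀ τ₁) ca cb cc cd clo chi bits a b c d vl vh) ∧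
    (clo = chi → (vl, vh) ∈ pieceE (.D τ₀ τ₁) ca cb cc cd clo chi bits a b c d vl vh) ∧
    (bits.1 = true → cc = clo → (c, vl) ∈ pieceE (.D τ₀ τ₁) ca cb cc cd clo chi bits a b c d vl vh) ∧
    (bits.1 = false → ca = chi → (a, vh) ∈ pieceE (.D τ₀ τ₁) ca cb cc cd clo chi bits a b c d vl vh) ∧
    (bits.2 = true → chi = cb → (vh, b) ∈ pieceE (.D τ₀ τ₁) ca cb cc cd clo chi bits a b c d vl vh) ∧
    (bits.2 = false → clo = cd → (vl, d) ∈ pieceE (.D τ₀ τ₁) ca cb cc cd clo chi bits a b c d vl vh) := by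
  refine ⟨?_, ?_, ?_, ?_, ?_, ?_, ?_, ?_, ?_, ?_, ?_⟩ <;> intros <;>
    simp_all [pieceE, List.mem_append, mem_ce]

/-- Membership of the level edge of an identity piece. [folklore] -/
theorem memI {W : Type*} (ca cb cc cd clo : Bool) (bits : Bool × Bool) (a b c d vl vh : W) :
    (vl, vh) ∈ pieceE .I ca cb cc cd clo clo bits a b c d vl vh := by
  simp [pieceE, List.mem_append, mem_ce]

variable [NeZero L]

/-- Level of a row. [folklore] -/
def pos (r : ZMod L) : Fin (L + 2) := ⟨r.val, by have := ZMod.val_lt r; omega⟩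

/-- Lift of block cells to necklace vertices. [folklore] -/
def χ (x : Fin 3 × ZMod L) : Vx L := if x.1 = 1 then Sum.inr (pos x.2) else Sum.inl x

/-- Levels of rows are among the first `L`. [folklore] -/
theorem pos_lt (r : ZMod L) : (pos r).val < L := ZMod.val_lt r

/-- The row of the level of a row. [folklore] -/
theorem pos_cast (r : ZMod L) : ((pos r).val : ZMod L) = r := ZMod.natCast_zmod_val r

/-- The three copies of row `0` of the middle column are joined in the start necklace. [folklore] -/
theorem wrapN (hL : 3 ≤ L) (τ : Fin 2 → Bool) (ξ ζ η : ZMod L → Bool) (a : Fin 2 × ZMod L → Bool)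
    (r : ZMod L) :
    (neckG (startNeck τ) ξ ζ (ι η a) fun _ => True).Reachable (Sum.inr (pos r + 1)) (Sum.inr (pos (r + 1))) := by
  haveI : Fact (1 < L) := ⟨by omega⟩
  by_cases h : r.val + 1 < L
  · have : pos (r + 1) = pos r + 1 := by
      apply Fin.ext
      rw [val_succ_of_lt _ (by have := pos_lt r; omega)]
      simp only [pos]
      rw [ZMod.val_add_of_lt (by rwa [ZMod.val_one]), ZMod.val_one]
    rw [this]
  · have hr : r.val + 1 = L := by have := ZMod.val_lt r; omega
    have h0 : r + 1 = 0 := by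
      have e : r + 1 = ((r.val + 1 : ℕ) : ZMod L) := by
        rw [Nat.cast_add, Nat.cast_one, ZMod.natCast_zmod_val]
      rw [e, hr, ZMod.natCast_self]
    have hp0 : pos (r + 1) = 0 := Fin.ext (by simp [pos, h0, ZMod.val_zero])
    have hpL : pos r + 1 = ⟨L, by omega⟩ := Fin.ext (by rw [val_succ_of_lt _ (by have := pos_lt r; omega)]; exact hr)
    rw [hp0, hpL]
    have hL0 : ¬ (⟨L, by omega⟩ : Fin (L + 2)).val < L := lt_irrefl _
    have hL1 : ¬ (⟨L + 1, by omega⟩ : Fin (L + 2)).val < L := by simp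
    have e1 : (⟨L, by omega⟩ : Fin (L + 2)) + 1 = ⟨L + 1, by omega⟩ := Fin.ext (val_succ_of_lt _ (by simp))
    have e2 : (⟨L + 1, by omega⟩ : Fin (L + 2)) + 1 = 0 :=
      Fin.ext (by rw [Fin.val_add, Fin.val_one, Fin.val_zero]; simp)
    have a1 := adjN (τ := τ) (ξ := ξ) (ζ := ζ) (η := η) (a := a) ⟨L, by omega⟩ (Sum.inr ⟨L, by omega⟩)
      (Sum.inr (⟨L, by omega⟩ + 1)) (by rw [start_I τ ξ ζ η a hL0]; apply memI)
      (by simp [(succ_ne _).symm])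
    have a2 := adjN (τ := τ) (ξ := ξ) (ζ := ζ) (η := η) (a := a) ⟨L + 1, by omega⟩
      (Sum.inr ⟨L + 1, by omega⟩) (Sum.inr (⟨L + 1, by omega⟩ + 1))
      (by rw [start_I τ ξ ζ η a hL1]; apply memI) (by simp [(succ_ne _).symm])
    rw [e1] at a1
    rw [e2] at a2
    exact a1.reachable.trans a2.reachable

/-- Edges of the double-face piece at the level of a row. [folklore] -/
theorem start_D_pos (τ : Fin 2 → Bool) (ξ ζ η : ZMod L → Bool) (a : Fin 2 × ZMod L → Bool) (r : ZMod L) :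
    pEdges ξ ζ (startNeck τ (pos r)) ((ι η a).1 (pos r)) ((ι η a).1 (pos r + 1)) ((ι η a).2 (pos r))
      (Sum.inr (pos r)) (Sum.inr (pos r + 1)) =
      pieceE (.D (τ 0) (τ 1)) (ξ r) (ζ r) (ξ (r + 1)) (ζ (r + 1)) (η r) (η (r + 1))
        (a (0, r), a (1, r)) (Sum.inl (0, r)) (Sum.inl (2, r)) (Sum.inl (0, r + 1)) (Sum.inl (2, r + 1))
        (Sum.inr (pos r)) (Sum.inr (pos r + 1)) := by
  rw [start_D τ ξ ζ η a (pos_lt r), pos_cast]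

/-- Lift of a middle cell. [folklore] -/
theorem χ_one (r : ZMod L) : χ ((1 : Fin 3), r) = Sum.inr (pos r) := by simp [χ]
/-- Lift of a left cell. [folklore] -/
theorem χ_zero (r : ZMod L) : χ ((0 : Fin 3), r) = Sum.inl (0, r) := by simp [χ]
/-- Lift of a right cell. [folklore] -/
theorem χ_two (r : ZMod L) : χ ((2 : Fin 3), r) = Sum.inl (2, r) := by simp [χ]

/-- The three elements of `Fin 3`. [folklore] -/
theorem fin3_cases (c : Fin 3) : c = 0 ∨ c = 1 ∨ c = 2 := by fin_cases c <;> simp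

/-- The two elements of `Fin 2`. [folklore] -/
theorem fin2_cases (j : Fin 2) : j = 0 ∨ j = 1 := by fin_cases j <;> simp

/-- Monochromatic block edges (raw orientation) lift to necklace paths. [folklore] -/
theorem M_to_N_core (hL : 3 ≤ L) (τ : Fin 2 → Bool) (ξ η ζ : ZMod L → Bool) (a : Fin 2 × ZMod L → Bool)
    (u v : Fin 3 × ZMod L)
    (hR : (v.1 = u.1 ∧ v.2 = u.2 + 1) ∨ (v.1.val = u.1.val + 1 ∧ v.2 = u.2) ∨
      (∃ j : Fin 2, u.1 = j.castSucc ∧ v.1 = j.succ ∧ v.2 = u.2 + 1 ∧ a (j, u.2) = false) ∨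
      (∃ j : Fin 2, u.1 = j.castSucc ∧ v.1 = j.succ ∧ u.2 = v.2 + 1 ∧ a (j, v.2) = true))
    (hc : colB ξ η ζ u = colB ξ η ζ v) :
    (neckG (startNeck τ) ξ ζ (ι η a) fun _ => True).Reachable (χ u) (χ v) := by
  have hr := row_succ_ne hL
  obtain ⟨c, r⟩ := u
  obtain ⟨c', r'⟩ := v
  have MD := fun r : ZMod L => memD (τ 0) (τ 1) (ξ r) (ζ r) (ξ (r + 1)) (ζ (r + 1)) (η r) (η (r + 1))
    (a (0, r), a (1, r)) (Sum.inl (0, r) : Vx L) (Sum.inl (2, r)) (Sum.inl (0, r + 1)) (Sum.inl (2, r + 1))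
    (Sum.inr (pos r)) (Sum.inr (pos r + 1))
  have AD : ∀ (r : ZMod L) (u v : Vx L), (u, v) ∈ pieceE (.D (τ 0) (τ 1)) (ξ r) (ζ r) (ξ (r + 1)) (ζ (r + 1))
      (η r) (η (r + 1)) (a (0, r), a (1, r)) (Sum.inl (0, r)) (Sum.inl (2, r)) (Sum.inl (0, r + 1))
      (Sum.inl (2, r + 1)) (Sum.inr (pos r)) (Sum.inr (pos r + 1)) → u ≠ v →
      (neckG (startNeck τ) ξ ζ (ι η a) fun _ => True).Reachable u v :=
    fun r u v h hne => (adjN (pos r) u v (by rw [start_D_pos]; exact h) hne).reachable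
  have hps : ∀ r : ZMod L, (Sum.inr (pos r) : Vx L) ≠ Sum.inr (pos r + 1) := fun r => by
    simp [(succ_ne _).symm]
  simp only at hR
  rcases hR with ⟨h1, h2⟩ | ⟨h1, h2⟩ | ⟨j, h1, h2, h3, hb⟩ | ⟨j, h1, h2, h3, hb⟩
  · -- vertical
    subst c' r'
    rcases fin3_cases c with rfl | rfl | rfl
    · simp only [colB] at hc
      rw [χ_zero, χ_zero]
      exact AD r _ _ ((MD r).1 (by simpa using hc)) (by simp [(hr r).symm])
    · simp only [colB] at hc
      rw [χ_one, χ_one]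
      exact (AD r _ _ ((MD r).2.2.2.2.2.2.1 (by simpa using hc)) (hps r)).trans (wrapN hL τ ξ ζ η a r)
    · simp only [colB] at hc
      rw [χ_two, χ_two]
      exact AD r _ _ ((MD r).2.1 (by simpa using hc)) (by simp [(hr r).symm])
  · -- horizontal
    subst r'
    rcases fin3_cases c with rfl | rfl | rfl <;> rcases fin3_cases c' with rfl | rfl | rfl <;>
      simp at h1
    · simp only [colB] at hc
      rw [χ_zero, χ_one]
      exact AD r _ _ ((MD r).2.2.1 (by simpa using hc)) Sum.inl_ne_inr
    · simp only [colB] at hc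
      rw [χ_one, χ_two]
      exact AD r _ _ ((MD r).2.2.2.1 (by simpa using hc)) Sum.inr_ne_inl
  · -- main diagonal
    subst c c' r'
    rcases fin2_cases j with rfl | rfl
    · simp only [colB] at hc
      rw [show Fin.castSucc (0 : Fin 2) = (0 : Fin 3) from rfl, show Fin.succ (0 : Fin 2) = (1 : Fin 3) from rfl,
        χ_zero, χ_one]
      exact (AD r _ _ ((MD r).2.2.2.2.2.2.2.2.1 hb (by simpa using hc)) Sum.inl_ne_inr).trans
        (wrapN hL τ ξ ζ η a r)
    · simp only [colB] at hc
      rw [show Fin.castSucc (1 : Fin 2) = (1 : Fin 3) from rfl, show Fin.succ (1 : Fin 2) = (2 : Fin 3) from rfl,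
        χ_one, χ_two]
      exact AD r _ _ ((MD r).2.2.2.2.2.2.2.2.2.2 hb (by simpa using hc)) Sum.inr_ne_inl
  · -- anti-diagonal
    subst c c' r
    rcases fin2_cases j with rfl | rfl
    · simp only [colB] at hc
      rw [show Fin.castSucc (0 : Fin 2) = (0 : Fin 3) from rfl, show Fin.succ (0 : Fin 2) = (1 : Fin 3) from rfl,
        χ_zero, χ_one]
      exact AD r' _ _ ((MD r').2.2.2.2.2.2.2.1 hb (by simpa using hc)) Sum.inl_ne_inr
    · simp only [colB] at hc
      rw [show Fin.castSucc (1 : Fin 2) = (1 : Fin 3) from rfl, show Fin.succ (1 : Fin 2) = (2 : Fin 3) from rfl,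
        χ_one, χ_two]
      exact (wrapN hL τ ξ ζ η a r').symm.trans
        (AD r' _ _ ((MD r').2.2.2.2.2.2.2.2.2.1 hb (by simpa using hc)) Sum.inr_ne_inl)

/-- Monochromatic block paths lift to necklace paths. [folklore] -/
theorem M_to_N (hL : 3 ≤ L) (τ : Fin 2 → Bool) (ξ η ζ : ZMod L → Bool) (a : Fin 2 × ZMod L → Bool)
    {u v : Fin 3 × ZMod L} (h : (monoG L (colB ξ η ζ) a).Reachable u v) :
    (neckG (startNeck τ) ξ ζ (ι η a) fun _ => True).Reachable (χ u) (χ v) := by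
  have step : ∀ u v, (monoG L (colB ξ η ζ) a).Adj u v →
      (neckG (startNeck τ) ξ ζ (ι η a) fun _ => True).Reachable (χ u) (χ v) := by
    rintro u v ⟨-, ⟨⟨-, hR | hR⟩, hc⟩ | ⟨⟨-, hR | hR⟩, hc⟩⟩
    · exact M_to_N_core hL τ ξ η ζ a u v hR hc
    · exact (M_to_N_core hL τ ξ η ζ a v u hR hc.symm).symm
    · exact (M_to_N_core hL τ ξ η ζ a v u hR hc).symm
    · exact M_to_N_core hL τ ξ η ζ a u v hR hc.symm
  obtain ⟨p⟩ := h
  induction p with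
  | nil => exact Reachable.refl _
  | @cons x y z hxy p ih => exact (step _ _ hxy).trans ih

/-- Boundary cells lift to themselves. [folklore] -/
theorem χ_bcell (p : Fin 2 × ZMod L) : χ (bcell p) = Sum.inl (bcell p) := by
  obtain ⟨s, r⟩ := p
  fin_cases s <;> simp [χ, bcell]

/-- DIAGRAM IDENTIFICATION: the start necklace induces the block diagram. [folklore] -/
theorem diag_start (hL : 3 ≤ L) (τ : Fin 2 → Bool) (ξ η ζ : ZMod L → Bool) (a : Fin 2 × ZMod L → Bool) :
    diagOf (neckG (startNeck τ) ξ ζ (ι η a) fun _ => True) = blockDiagram L (colB ξ η ζ) a := by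
  ext ⟨p, q⟩
  simp only [diagOf, blockDiagram, Set.mem_setOf_eq]
  rw [show (((![0, 2] : Fin 2 → Fin 3) q.1, q.2) : Fin 3 × ZMod L) = bcell q from rfl,
    show (((![0, 2] : Fin 2 → Fin 3) p.1, p.2) : Fin 3 × ZMod L) = bcell p from rfl, mem_blockCluster_iff]
  constructor
  · intro h; exact N_to_M hL τ ξ η ζ a h
  · intro h; simpa only [χ_bcell] using M_to_N hL τ ξ η ζ a h

end Bridge

end DX

/-- REGISTERED SUB-GOAL of part 4: the start necklace induces the block diagram. [folklore] -/
theorem diagramExchange_startDiagram : ∀ {L : ℕ} [NeZero L], 3 ≤ L → ∀ (τ : Fin 2 → Bool) (ξ η ζ : ZMod L → Bool) (a : Fin 2 × ZMod L → Bool), DX.diagOf (DX.neckG (DX.startNeck τ) ξ ζ (DX.ι η a) fun _ => True) = blockDiagram L (DX.colB ξ η ζ) a :=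
  fun hL => DX.diag_start hL

end Summit.CriticalPhenomena.CardyFormulaZ2.Theorems.IKLinearTransport.PinnedDiagramExchange
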